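import Summits.BirchSwinnertonDyer.BirchSwinnertonDyer.Theorems.CumulativeHeegnerLeopoldtCumulativeHeegnerInclusionAtThreeStrassmannDivision
import Mathlib.NumberTheory.Padics.Complex
import HarnessLib

/-!
# Crux K1 `CumulativeHeegnerInclusionAtThree` (stmt-BirchSwinnertonDyer-24198), stub A = crux stmt-26896:
# STRASSMANN'S THEOREM, part 2 — a power series converging on a CLOSED ball of a complete ultrametric field
# has finitely many zeros there (at most its Strassmann index); hence a series converging on the OPEN unit
# disc of `ℂ_p` (bounded, tempered, `𝓗_h`, …) has finitely many zeros in every closed sub-ball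

Width seat `bsd-line-chl-k1-p1-w2` (g3) of the K1 line `birth` (route `CumulativeHeegnerLeopoldt`, rev 5).
Helper toward stub A (`--supports stmt-BirchSwinnertonDyer-24198`); THEOREMS ONLY (no definition, no named fact,
no `sorry`). Part 1 (`…StrassmannDivision`, same namespace) supplies the tools and the division step.
BSD is not proved by any of this; no summit statement is proved by this file.

## Why

The K1 lead's transfer theorem for a tempered A-line (p624927
`…UnrSeriesTemperedDomination.exists_C_pow_mul_mem_span_of_norm_value_le_on_closedBalls`) takes as input, for
every radius `ρ < 1`, a domination `‖L(x)‖ ≤ C_ρ ‖g(x)‖` on the closed ball `‖x‖ ≤ ρ` OFF A FINITE SET `F_ρ`.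
In a tempered argument the exceptional sets are zero sets, inside `‖x‖ ≤ ρ`, of auxiliary series that are
NOT bounded (the order-1 multiplier `m(T)` of the reciprocity law, `log`-type factors): such a series may have
infinitely many zeros in the open disc (`log(1+T)` vanishes at every `ζ - 1`), so the tree's finiteness
results — all via Weierstrass preparation for BOUNDED series (`MemIwasawaRat.finite_setOf_hasSum_zero`,
`…UnrSeriesZeros.finite_zeros`) — do not apply. Strassmann's theorem is the statement that does: on each
CLOSED ball of radius `ρ < 1` the zeros are finitely many, for any series converging there. (The companion
file `…TemperedRigidity`, p626716, treats the identity principle at an interior ACCUMULATION point.)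

## What is proved (over `𝕜` complete, nontrivially normed, `IsUltrametricDist`)

* §3 **`strassmann`**: with Strassmann data at `N` (`a_N ≠ 0`, `‖a_k‖ρ^k ≤ ‖a_N‖ρ^N`, `<` beyond `N`), the set
  `{x | ‖x‖ ≤ ρ ∧ ∑ a_k x^k = 0}` is finite of cardinality `≤ N` (induction on `N` through the division step);
  `finite_zeros_closedBall` (`‖a_k‖ρ^k → 0`, `a ≠ 0` ⟹ finite); `eq_zero_of_infinite_zeros_closedBall`;
  `eq_of_infinite_hasSum_eq_closedBall`.
* §4 open-disc corollaries: `norm_mul_pow_tendsto_zero_of_le` (a bound at radius `ρ' > ρ` gives convergence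
  on `‖x‖ ≤ ρ`), `norm_mul_pow_tendsto_zero_of_tempered` (`‖a_k‖ ≤ C (k+1)^h` ⟹ every `ρ < 1`),
  `finite_zeros_closedBall_of_forall_lt_one`, `eq_zero_of_infinite_zeros_of_forall_lt_one`.
* §5 over `ℂ_p`: `PadicComplex.finite_zeros_closedBall_of_tempered`, `PadicComplex.eq_of_infinite_eq_of_tempered`,
  (the BDP range `{u^m - 1}` of a principal unit `u` lies in the closed ball of radius `‖u - 1‖ < 1`: tree
  `X11b.R1.norm_pow_sub_one_le`, `FramePrincipalUnitPowers.lean`).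

References: [Cassels1986] J. W. S. Cassels, *Local Fields*, LMS Student Texts 3, CUP 1986, Ch. 4 Thm. 4.1
(Strassmann's theorem) and Cor.; [PerrinRiou1994Invent] §1.1 (the algebras `𝓗_h`).
-/

noncomputable section

-- D-0017: single-problem summit, `Summit.BirchSwinnertonDyer.BirchSwinnertonDyer.…` repeats a namespace BY DESIGN.
set_option linter.dupNamespace false
set_option autoImplicit false

open scoped Classical Topology

open Filter Finset

namespace Summit.BirchSwinnertonDyer.BirchSwinnertonDyer.Theorems.CumulativeHeegnerInclusionAtThreeStrassmann

/-! ### §3 Strassmann's theorem -/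

section Strassmann

variable {𝕜 : Type*} [NontriviallyNormedField 𝕜] [IsUltrametricDist 𝕜] [CompleteSpace 𝕜]

/-- **Strassmann's theorem** (Cassels, *Local Fields*, Ch. 4 Thm. 4.1). Over a complete nontrivially normed
ultrametric field `𝕜`, let `‖a_k‖ ρ^k → 0` (`ρ > 0`; the series `∑ a_k x^k` converges for `‖x‖ ≤ ρ`) and let
`N` carry the Strassmann data (`a_N ≠ 0`, `‖a_k‖ ρ^k ≤ ‖a_N‖ ρ^N` for all `k`, `<` for `k > N`). Then the
zeros of the series in the closed ball `‖x‖ ≤ ρ` form a finite set with at most `N` elements. Proof by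
induction on `N`: for `N = 0` the constant term dominates and there is no zero; otherwise divide by `y - x`
at a zero `x` (§2), the quotient has its data at `N - 1`. [cite: Cassels1986, Ch. 4 Thm. 4.1] -/
theorem strassmann {ρ : ℝ} (hρ : 0 < ρ) :
    ∀ (N : ℕ) (a : ℕ → 𝕜), Tendsto (fun k ↦ ‖a k‖ * ρ ^ k) atTop (𝓝 0) → a N ≠ 0 →
      (∀ k, ‖a k‖ * ρ ^ k ≤ ‖a N‖ * ρ ^ N) → (∀ k, N < k → ‖a k‖ * ρ ^ k < ‖a N‖ * ρ ^ N) →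
      {x : 𝕜 | ‖x‖ ≤ ρ ∧ HasSum (fun k ↦ a k * x ^ k) 0}.Finite ∧
        {x : 𝕜 | ‖x‖ ≤ ρ ∧ HasSum (fun k ↦ a k * x ^ k) 0}.ncard ≤ N := by
  intro N
  induction N with
  | zero =>
    intro a ha h0 hle hlt
    -- no zeros: the constant term dominates
    have hempty : {x : 𝕜 | ‖x‖ ≤ ρ ∧ HasSum (fun k ↦ a k * x ^ k) 0} = ∅ := by
      ext x
      simp only [Set.mem_setOf_eq, Set.mem_empty_iff_false, iff_false, not_and]
      intro hx hsum
      have hM : 0 < ‖a 0‖ * ρ ^ 0 := mul_pos (norm_pos_iff.mpr h0) (pow_pos hρ _)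
      obtain ⟨M', hM'M, hM'⟩ := exists_lt_forall_le_of_tendsto_zero ha hM (P := fun k ↦ 0 < k) hlt
      have hs := summable_mul_pow ha hx
      have hval : ∑' k, a k * x ^ k = 0 := hsum.tsum_eq
      rw [hs.tsum_eq_zero_add, pow_zero, mul_one] at hval
      have hnorm := norm_add_tsum_eq_of_lt (u := a 0) (g := fun k ↦ a (k + 1) * x ^ (k + 1))
        (M' := M') (by simpa using hM'M) fun i ↦ (norm_mul_pow_le hx (i + 1)).trans (hM' _ (by omega))
      rw [hval, norm_zero] at hnorm
      exact h0 (norm_eq_zero.mp hnorm.symm)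
    rw [hempty]
    exact ⟨Set.finite_empty, by simp⟩
  | succ N ih =>
    intro a ha h0 hle hlt
    set Z := {x : 𝕜 | ‖x‖ ≤ ρ ∧ HasSum (fun k ↦ a k * x ^ k) 0} with hZ_def
    by_cases hZ : Z = ∅
    · rw [hZ]; exact ⟨Set.finite_empty, by simp⟩
    obtain ⟨x, hxρ, hx0⟩ := Set.nonempty_iff_ne_empty.mpr hZ
    -- divide by `y - x`
    set b : ℕ → 𝕜 := fun j ↦ ∑' i, a (j + 1 + i) * x ^ i with hb_def
    have hb : Tendsto (fun j ↦ ‖b j‖ * ρ ^ j) atTop (𝓝 0) := norm_quotientCoeff_mul_pow_tendsto_zero hρ ha hxρ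
    obtain ⟨hbN0, hble, hblt⟩ := strassmannData_quotient hρ ha h0 hle hlt hxρ
    obtain ⟨hfin, hcard⟩ := ih b hb hbN0 hble hblt
    -- every zero of `a` other than `x` is a zero of `b`
    have hsub : Z ⊆ insert x {y : 𝕜 | ‖y‖ ≤ ρ ∧ HasSum (fun k ↦ b k * y ^ k) 0} := by
      rintro y ⟨hyρ, hy0⟩
      by_cases hyx : y = x
      · exact Or.inl hyx
      refine Or.inr ⟨hyρ, ?_⟩
      have hid := tsum_sub_tsum_eq_mul_tsum hρ ha hxρ hyρ
      rw [hy0.tsum_eq, hx0.tsum_eq, sub_zero, zero_eq_mul] at hid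
      rcases hid with hxy | hG
      · exact absurd (sub_eq_zero.mp hxy) hyx
      · rw [← hG]
        exact (summable_mul_pow hb hyρ).hasSum
    refine ⟨(hfin.insert x).subset hsub, ?_⟩
    calc Z.ncard ≤ (insert x {y : 𝕜 | ‖y‖ ≤ ρ ∧ HasSum (fun k ↦ b k * y ^ k) 0}).ncard :=
          Set.ncard_le_ncard hsub (hfin.insert x)
      _ ≤ {y : 𝕜 | ‖y‖ ≤ ρ ∧ HasSum (fun k ↦ b k * y ^ k) 0}.ncard + 1 := Set.ncard_insert_le _ _
      _ ≤ N + 1 := by omega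

/-- **Finitely many zeros on a closed ball of convergence.** If `‖a_k‖ ρ^k → 0` (`ρ > 0`) and `a ≠ 0`, the
series `∑ a_k x^k` has finitely many zeros in `‖x‖ ≤ ρ`. [cite: Cassels1986, Ch. 4 Thm. 4.1] -/
theorem finite_zeros_closedBall {a : ℕ → 𝕜} {ρ : ℝ} (hρ : 0 < ρ)
    (ha : Tendsto (fun k ↦ ‖a k‖ * ρ ^ k) atTop (𝓝 0)) (hne : a ≠ 0) :
    {x : 𝕜 | ‖x‖ ≤ ρ ∧ HasSum (fun k ↦ a k * x ^ k) 0}.Finite := by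
  obtain ⟨N, hN0, hle, hlt⟩ := exists_strassmannIndex hρ ha (Function.ne_iff.mp hne)
  exact (strassmann hρ N a ha hN0 hle hlt).1

/-- **Identity principle on a closed ball (no accumulation needed)**: a series with `‖a_k‖ ρ^k → 0` that
vanishes at infinitely many points of `‖x‖ ≤ ρ` is `0`. [cite: Cassels1986, Ch. 4 Thm. 4.1 and Cor.] -/
theorem eq_zero_of_infinite_zeros_closedBall {a : ℕ → 𝕜} {ρ : ℝ} (hρ : 0 < ρ)
    (ha : Tendsto (fun k ↦ ‖a k‖ * ρ ^ k) atTop (𝓝 0))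
    (hinf : {x : 𝕜 | ‖x‖ ≤ ρ ∧ HasSum (fun k ↦ a k * x ^ k) 0}.Infinite) : a = 0 := by
  by_contra hne
  exact hinf (finite_zeros_closedBall hρ ha hne)

/-- **Two series converging on the closed ball `‖x‖ ≤ ρ` that agree at infinitely many of its points are
equal.** [cite: Cassels1986, Ch. 4 Thm. 4.1 and Cor.] -/
theorem eq_of_infinite_hasSum_eq_closedBall {a a' : ℕ → 𝕜} {ρ : ℝ} (hρ : 0 < ρ)
    (ha : Tendsto (fun k ↦ ‖a k‖ * ρ ^ k) atTop (𝓝 0)) (ha' : Tendsto (fun k ↦ ‖a' k‖ * ρ ^ k) atTop (𝓝 0))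
    (hinf : {x : 𝕜 | ‖x‖ ≤ ρ ∧ ∃ v, HasSum (fun k ↦ a k * x ^ k) v ∧ HasSum (fun k ↦ a' k * x ^ k) v}.Infinite) :
    a = a' := by
  have hsub : Tendsto (fun k ↦ ‖(a - a') k‖ * ρ ^ k) atTop (𝓝 0) := by
    have h2 := ha.add ha'
    rw [add_zero] at h2
    refine squeeze_zero (fun k ↦ mul_nonneg (norm_nonneg _) (pow_nonneg hρ.le _)) (fun k ↦ ?_) h2
    rw [Pi.sub_apply, ← add_mul]
    exact mul_le_mul_of_nonneg_right (norm_sub_le _ _) (pow_nonneg hρ.le _)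
  have key : a - a' = 0 := by
    refine eq_zero_of_infinite_zeros_closedBall hρ hsub (hinf.mono ?_)
    rintro x ⟨hx, v, hv, hv'⟩
    refine ⟨hx, ?_⟩
    have h := hv.sub hv'
    rw [sub_self] at h
    refine h.congr_fun fun k ↦ ?_
    rw [Pi.sub_apply, sub_mul]
  exact sub_eq_zero.mp key

end Strassmann

/-! ### §4 Series converging on the open unit disc (bounded, tempered, …) -/

section OpenDisc

variable {𝕜 : Type*} [NontriviallyNormedField 𝕜] [IsUltrametricDist 𝕜] [CompleteSpace 𝕜]

omit [IsUltrametricDist 𝕜] [CompleteSpace 𝕜] in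
/-- **A bound at a larger radius gives convergence on the smaller closed ball**: `‖a_k‖ ρ'^k ≤ C` with
`0 ≤ ρ < ρ'` implies `‖a_k‖ ρ^k → 0` (geometric decay `(ρ/ρ')^k`). [folklore] -/
theorem norm_mul_pow_tendsto_zero_of_le {a : ℕ → 𝕜} {ρ ρ' C : ℝ} (hρ : 0 ≤ ρ) (hρρ' : ρ < ρ')
    (hC : ∀ k, ‖a k‖ * ρ' ^ k ≤ C) : Tendsto (fun k ↦ ‖a k‖ * ρ ^ k) atTop (𝓝 0) := by
  have hρ'0 : 0 < ρ' := hρ.trans_lt hρρ'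
  have hC0 : 0 ≤ C := (mul_nonneg (norm_nonneg _) (pow_nonneg hρ'0.le _)).trans (hC 0)
  have hq : ρ / ρ' < 1 := (div_lt_one hρ'0).mpr hρρ'
  have hgeo : Tendsto (fun k ↦ C * (ρ / ρ') ^ k) atTop (𝓝 0) := by
    have := (tendsto_pow_atTop_nhds_zero_of_lt_one (div_nonneg hρ hρ'0.le) hq).const_mul C
    rwa [mul_zero] at this
  refine squeeze_zero (fun k ↦ mul_nonneg (norm_nonneg _) (pow_nonneg hρ _)) (fun k ↦ ?_) hgeo
  rw [div_pow, mul_div_assoc', le_div_iff₀ (pow_pos hρ'0 _)]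
  calc ‖a k‖ * ρ ^ k * ρ' ^ k = ‖a k‖ * ρ' ^ k * ρ ^ k := by ring
    _ ≤ C * ρ ^ k := mul_le_mul_of_nonneg_right (hC k) (pow_nonneg hρ _)

omit [IsUltrametricDist 𝕜] [CompleteSpace 𝕜] in
/-- **Tempered coefficients converge on every closed sub-ball of the open unit disc**: `‖a_k‖ ≤ C (k+1)^h`
(growth of order `h`, Perrin-Riou's `𝓗_h`) gives `‖a_k‖ ρ^k → 0` for every `0 ≤ ρ < 1`.
[cite: PerrinRiou1994Invent, §1.1 (the algebras 𝓗_h)] -/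
theorem norm_mul_pow_tendsto_zero_of_tempered {a : ℕ → 𝕜} {C : ℝ} {h : ℕ}
    (ha : ∀ k, ‖a k‖ ≤ C * ((k : ℝ) + 1) ^ h) {ρ : ℝ} (hρ0 : 0 ≤ ρ) (hρ1 : ρ < 1) :
    Tendsto (fun k ↦ ‖a k‖ * ρ ^ k) atTop (𝓝 0) := by
  have hC0 : 0 ≤ C := by
    have := (norm_nonneg (a 0)).trans (ha 0)
    simpa using this
  -- `(k+1)^h ρ^k → 0`
  have hlim : Tendsto (fun k : ℕ ↦ C * (((k : ℝ) + 1) ^ h * ρ ^ k)) atTop (𝓝 0) := by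
    rcases hρ0.eq_or_lt with hρ | hρ
    · rw [← hρ]
      refine tendsto_atTop_of_eventually_const (i₀ := 1) fun n hn ↦ ?_
      rw [zero_pow (by omega), mul_zero, mul_zero]
    · have h1 : Tendsto (fun m : ℕ ↦ (m : ℝ) ^ h * ρ ^ m) atTop (𝓝 0) :=
        tendsto_pow_const_mul_const_pow_of_abs_lt_one h (by rwa [abs_of_pos hρ])
      have h2 : Tendsto (fun n : ℕ ↦ C * ((((n + 1 : ℕ) : ℝ)) ^ h * ρ ^ (n + 1) * ρ⁻¹)) atTop (𝓝 0) := by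
        have := ((h1.comp (tendsto_add_atTop_nat 1)).mul_const ρ⁻¹).const_mul C
        rwa [zero_mul, mul_zero] at this
      refine h2.congr fun n ↦ ?_
      rw [pow_succ, Nat.cast_add, Nat.cast_one]
      field_simp
  refine squeeze_zero (fun k ↦ mul_nonneg (norm_nonneg _) (pow_nonneg hρ0 _)) (fun k ↦ ?_) hlim
  calc ‖a k‖ * ρ ^ k ≤ C * ((k : ℝ) + 1) ^ h * ρ ^ k := mul_le_mul_of_nonneg_right (ha k) (pow_nonneg hρ0 k)
    _ = C * (((k : ℝ) + 1) ^ h * ρ ^ k) := by ring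

/-- **Series converging on the open unit disc have finitely many zeros in every closed sub-ball**: if for
every `ρ' < 1` there is `C_{ρ'}` with `‖a_k‖ ρ'^k ≤ C_{ρ'}` (bounded series, tempered series, any element of
the Fréchet algebra of the open disc) and `a ≠ 0`, then for every `0 < ρ < 1` the zero set in `‖x‖ ≤ ρ` is
finite. This is the supplier of the finite exceptional sets `F_ρ` in the closed-ball domination hypothesis of
`…UnrSeriesTemperedDomination.exists_C_pow_mul_mem_span_of_norm_value_le_on_closedBalls` (p624927).
[cite: Cassels1986, Ch. 4 Thm. 4.1] -/
theorem finite_zeros_closedBall_of_forall_lt_one {a : ℕ → 𝕜}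
    (ha : ∀ ρ' : ℝ, ρ' < 1 → ∃ C, ∀ k, ‖a k‖ * ρ' ^ k ≤ C) (hne : a ≠ 0) {ρ : ℝ} (hρ0 : 0 < ρ)
    (hρ1 : ρ < 1) : {x : 𝕜 | ‖x‖ ≤ ρ ∧ HasSum (fun k ↦ a k * x ^ k) 0}.Finite := by
  obtain ⟨C, hC⟩ := ha ((ρ + 1) / 2) (by linarith)
  exact finite_zeros_closedBall hρ0 (norm_mul_pow_tendsto_zero_of_le hρ0.le (by linarith) hC) hne

/-- **Identity principle on closed sub-balls of the open disc**: such a series vanishing at infinitely many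
points of some closed ball `‖x‖ ≤ ρ < 1` is `0` — in contrast with the torsion points `ζ - 1`, which tend to
the rim and do not pin `log(1+T)`. [cite: Cassels1986, Ch. 4 Thm. 4.1 and Cor.] -/
theorem eq_zero_of_infinite_zeros_of_forall_lt_one {a : ℕ → 𝕜}
    (ha : ∀ ρ' : ℝ, ρ' < 1 → ∃ C, ∀ k, ‖a k‖ * ρ' ^ k ≤ C) {ρ : ℝ} (hρ0 : 0 < ρ) (hρ1 : ρ < 1)
    (hinf : {x : 𝕜 | ‖x‖ ≤ ρ ∧ HasSum (fun k ↦ a k * x ^ k) 0}.Infinite) : a = 0 := by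
  by_contra hne
  exact hinf (finite_zeros_closedBall_of_forall_lt_one ha hne hρ0 hρ1)

end OpenDisc

/-! ### §5 The instances over `ℂ_p` used by the K1 line -/

section PadicComplex

variable {p : ℕ} [Fact p.Prime]

/-- **Over `ℂ_p`: a non-zero TEMPERED series (`‖a_k‖ ≤ C (k+1)^h`) has finitely many zeros in every closed
ball `‖x‖ ≤ ρ < 1`.** [cite: Cassels1986, Ch. 4 Thm. 4.1] [cite: PerrinRiou1994Invent, §1.1] -/
theorem PadicComplex.finite_zeros_closedBall_of_tempered {a : ℕ → ℂ_[p]} {C : ℝ} {h : ℕ}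
    (ha : ∀ k, ‖a k‖ ≤ C * ((k : ℝ) + 1) ^ h) (hne : a ≠ 0) {ρ : ℝ} (hρ0 : 0 < ρ) (hρ1 : ρ < 1) :
    {x : ℂ_[p] | ‖x‖ ≤ ρ ∧ HasSum (fun k ↦ a k * x ^ k) 0}.Finite :=
  finite_zeros_closedBall hρ0 (norm_mul_pow_tendsto_zero_of_tempered ha hρ0.le hρ1) hne

/-- **Over `ℂ_p`: two tempered series that agree at infinitely many points of one closed ball
`‖x‖ ≤ ρ < 1` are equal** (e.g. agreeing on the BDP interpolation range `{u^m - 1}`, `u ≠ 1` a principal unit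
of infinite order, which lies in the closed ball of radius `‖u - 1‖ < 1` — tree `X11b.R1.norm_pow_sub_one_le`).
[cite: Cassels1986, Ch. 4 Thm. 4.1 and Cor.] [cite: PerrinRiou1994Invent, §1.1] -/
theorem PadicComplex.eq_of_infinite_eq_of_tempered {a a' : ℕ → ℂ_[p]} {C C' : ℝ} {h h' : ℕ}
    (ha : ∀ k, ‖a k‖ ≤ C * ((k : ℝ) + 1) ^ h) (ha' : ∀ k, ‖a' k‖ ≤ C' * ((k : ℝ) + 1) ^ h')
    {ρ : ℝ} (hρ0 : 0 < ρ) (hρ1 : ρ < 1)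
    (hinf : {x : ℂ_[p] | ‖x‖ ≤ ρ ∧
      ∃ v, HasSum (fun k ↦ a k * x ^ k) v ∧ HasSum (fun k ↦ a' k * x ^ k) v}.Infinite) : a = a' :=
  eq_of_infinite_hasSum_eq_closedBall hρ0 (norm_mul_pow_tendsto_zero_of_tempered ha hρ0.le hρ1)
    (norm_mul_pow_tendsto_zero_of_tempered ha' hρ0.le hρ1) hinf

end PadicComplex

end Summit.BirchSwinnertonDyer.BirchSwinnertonDyer.Theorems.CumulativeHeegnerInclusionAtThreeStrassmann

end
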